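import Mathlib
import HarnessLib

/-!
# The sifted initial segment of a Maier matrix: exact inclusion–exclusion and its oscillation

Topic `Literature/NumberTheory/Sieve` (grouping namespace `MaierMatrix`). Everything here is
PROVED; the definitions are elementary bookkeeping objects.

In Maier's matrix method (Maier 1985; Soundararajan 2007, Lecture 3, (3.1)–(3.4); Granville–
Soundararajan 2007, §1b) the columns `j ≤ h` of the matrix `(rP + j)` that can contain primes are
those with `(j, P) = 1`, `P = ∏_{p ∈ S} p`, and the method rests on the fact that their number
`N_S(h) = #{1 ≤ j ≤ h : p ∤ j ∀ p ∈ S}` is NOT `∼ h ∏_{p∈S}(1 − 1/p)` when `h` is short compared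
with the products of the primes in `S` ("(3.3) should hold … where is the contradiction? … in
Maier's application `h` is very small compared with `P`, and so (3.4) is useless", Soundararajan
p. 8). We prove the elementary exact-truncation form of this phenomenon used in Soundararajan's
Exercise 11: if every `p ∈ S` exceeds `w ≥ 1` and `h ≤ w^{k+1}`, then the Legendre sum for
`N_S(h)` truncates after `k`-fold products and

  `N_S(h) = h W(S) + (−1)^k h g_k(S) + O_≤((k+1)(#S+1)^k)`,  `W(S) = ∏_{p∈S}(1 − 1/p)`,

where the tail `g_k(S) = e_{k+1} − e_{k+2} + …` (elementary symmetric functions of `{1/p}`)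
satisfies `g_k(S) ≥ W(S) e_{k+1}(S) ≥ 0` and `e_j(S) ≥ (e_1(S) − (j−1)m)_+^j / j!` when
`1/p ≤ m` on `S`. Hence `N_S(h)` exceeds `hW(1 + e_{k+1}) − O(…)` for even `k` and is below
`hW(1 − e_{k+1}) + O(…)` for odd `k`: the sign of the deviation is governed by the parity of the
number of prime factors that `h` can "see" — the first sign changes of `ω(u) − e^{−γ}` for the
Buchstab function in this discrete model.

## Main results

* `siftedCount_eq_sum` — Legendre: `N_S(h) = ∑_{t ⊆ S} (−1)^{#t} ⌊h/∏t⌋`.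
* `sieveDensity_eq_sum` — `W(S) = ∑_{t ⊆ S} (−1)^{#t}/∏t`.
* `gTail_insert`, `sieveDensity_mul_eSymm_le_gTail` — `g_k(S ∪ {q}) = (1 − 1/q) g_k(S) + e_k(S)/q`,
  whence `W e_{k+1} ≤ g_k`.
* `pow_div_factorial_le_eSymm` — `(e_1 − (j−1)m)_+^j/j! ≤ e_j`; `eSymm_eq_esymm` identifies `e_k`
  with Mathlib's `Multiset.esymm` of the reciprocals.
* `abs_siftedCount_sub_le` — the truncation estimate displayed above;
  `siftedCount_ge_of_even`, `siftedCount_le_of_odd` — the two one-sided consequences.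
* glue for the modulus `P = ∏_{p∈S} p`: `siftedCount_eq_card_coprime`, `sieveDensity_eq_totient_div`
  (`W(S) = φ(P)/P`), `one_sub_sum_le_sieveDensity` (`W ≥ 1 − ∑ 1/p`).

## References

* K. Soundararajan, *The distribution of prime numbers*, in: Equidistribution in number theory
  (Springer 2007), arXiv:math/0606408, Lecture 3, (3.1)–(3.4) and Exercise 11
  (`Soundararajan2007Distribution`).
* H. Maier, *Primes in short intervals*, Michigan Math. J. 32 (1985), 221–225 (`Maier1985`).
-/

noncomputable section

open Finset

namespace Literature.NumberTheory.Sieve.MaierMatrix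

/-! ## The objects -/

/-- `N_S(h) = #{1 ≤ j ≤ h : p ∤ j for all p ∈ S}`, the number of integers of `[1, h]` surviving the
sieve by the primes of `S` (the admissible columns of a Maier matrix of width `h`).
[cite: Soundararajan2007Distribution, Lecture 3 eq. (3.3)] -/
def siftedCount (S : Finset ℕ) (h : ℕ) : ℕ :=
  #{j ∈ Icc 1 h | ∀ p ∈ S, ¬ p ∣ j}

/-- `W(S) = ∏_{p ∈ S} (1 − 1/p)` (`= φ(P)/P` for `P = ∏_{p∈S} p`).
[cite: Soundararajan2007Distribution, Lecture 3 eq. (3.3)] -/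
def sieveDensity (S : Finset ℕ) : ℝ :=
  ∏ p ∈ S, (1 - (p : ℝ)⁻¹)

/-- `e_k(S) = ∑_{t ⊆ S, #t = k} ∏_{p ∈ t} 1/p`, the `k`-th elementary symmetric function of the
reciprocals `{1/p : p ∈ S}`, i.e. Mathlib's `Multiset.esymm` of the multiset `S.val.map (1/·)`
(`eSymm_eq_esymm`); written as a sum over the whole powerset with an indicator because the
recursions below (`eSymm_insert_succ`, `gTail_insert`) are proved through `Finset.sum_powerset_insert`.
[folklore] -/
def eSymm (S : Finset ℕ) (k : ℕ) : ℝ :=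
  ∑ t ∈ S.powerset, if #t = k then ∏ p ∈ t, (p : ℝ)⁻¹ else 0

/-- `eSymm S k` is Mathlib's elementary symmetric function `Multiset.esymm` of the multiset of
reciprocals `S.val.map (p ↦ 1/p)` (bridge to the `esymm` API, via `Finset.esymm_map_val` and
`Finset.powersetCard_eq_filter`). [folklore] -/
theorem eSymm_eq_esymm (S : Finset ℕ) (k : ℕ) :
    eSymm S k = (S.val.map fun p : ℕ ↦ (p : ℝ)⁻¹).esymm k := by
  rw [Finset.esymm_map_val, eSymm, ← Finset.sum_filter, Finset.powersetCard_eq_filter]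

/-- `g_k(S) = ∑_{t ⊆ S, #t > k} (−1)^{#t + k + 1} ∏_{p∈t} 1/p = e_{k+1}(S) − e_{k+2}(S) + ⋯`, the signed
tail of `∏_{p ∈ S}(1 − 1/p) = ∑_j (−1)^j e_j(S)` after the `k`-th term. [folklore] -/
def gTail (S : Finset ℕ) (k : ℕ) : ℝ :=
  ∑ t ∈ S.powerset, if k < #t then (-1 : ℝ) ^ (#t + k + 1) * ∏ p ∈ t, (p : ℝ)⁻¹ else 0

/-! ## Legendre's identity -/

/-- Inclusion–exclusion for the indicator of "`p ∤ j` for all `p ∈ S`" over a set `S` of primes: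
`𝟙[∀ p ∈ S, p ∤ j] = ∑_{t ⊆ S} (−1)^{#t} 𝟙[∏t ∣ j]`. [folklore] -/
theorem indicator_sifted_eq_sum (S : Finset ℕ) (hS : ∀ p ∈ S, p.Prime) (j : ℕ) :
    (if (∀ p ∈ S, ¬ p ∣ j) then (1 : ℝ) else 0) =
      ∑ t ∈ S.powerset, (-1 : ℝ) ^ #t * (if (∏ p ∈ t, p) ∣ j then 1 else 0) := by
  classical
  induction S using Finset.induction_on with
  | empty => simp
  | insert q S hq ih =>
    have hS' : ∀ p ∈ S, p.Prime := fun p hp ↦ hS p (mem_insert_of_mem hp)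
    have hqp : q.Prime := hS q (mem_insert_self q S)
    rw [sum_powerset_insert hq]
    -- the second sum: `∏(insert q t) = q ∏ t`, and `q ∏t ∣ j ↔ q ∣ j ∧ ∏t ∣ j`
    have h2 : ∀ t ∈ S.powerset,
        (-1 : ℝ) ^ #(insert q t) * (if (∏ p ∈ insert q t, p) ∣ j then (1 : ℝ) else 0) =
          -((if q ∣ j then (1 : ℝ) else 0) *
            ((-1 : ℝ) ^ #t * (if (∏ p ∈ t, p) ∣ j then 1 else 0))) := by
      intro t ht
      have htS : t ⊆ S := mem_powerset.1 ht
      have hqt : q ∉ t := fun h ↦ hq (htS h)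
      rw [card_insert_of_notMem hqt, prod_insert hqt, pow_succ]
      have hcop : q.Coprime (∏ p ∈ t, p) := by
        refine Nat.Coprime.prod_right fun p hp ↦ ?_
        have hpp : p.Prime := hS' p (htS hp)
        exact (Nat.coprime_primes hqp hpp).2 fun h ↦ hqt (h ▸ hp)
      have hiff : q * ∏ p ∈ t, p ∣ j ↔ q ∣ j ∧ (∏ p ∈ t, p) ∣ j :=
        ⟨fun h ↦ ⟨(dvd_mul_right q _).trans h, (dvd_mul_left _ q).trans h⟩,
          fun h ↦ hcop.mul_dvd_of_dvd_of_dvd h.1 h.2⟩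
      by_cases hqj : q ∣ j
      · by_cases htj : (∏ p ∈ t, p) ∣ j
        · rw [if_pos (hiff.2 ⟨hqj, htj⟩), if_pos hqj, if_pos htj]; ring
        · rw [if_neg (fun h ↦ htj (hiff.1 h).2), if_pos hqj, if_neg htj]; ring
      · rw [if_neg (fun h ↦ hqj (hiff.1 h).1), if_neg hqj]; ring
    rw [sum_congr rfl h2, sum_neg_distrib, ← mul_sum, ← ih hS']
    -- both sides are indicators
    by_cases hqj : q ∣ j
    · rw [if_pos hqj]
      have : ¬ (∀ p ∈ insert q S, ¬ p ∣ j) := fun h ↦ h q (mem_insert_self q S) hqj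
      rw [if_neg this]
      ring
    · rw [if_neg hqj]
      by_cases hall : ∀ p ∈ S, ¬ p ∣ j
      · have : ∀ p ∈ insert q S, ¬ p ∣ j := by
          intro p hp
          rcases mem_insert.1 hp with rfl | hp
          · exact hqj
          · exact hall p hp
        rw [if_pos this, if_pos hall]; ring
      · have : ¬ ∀ p ∈ insert q S, ¬ p ∣ j := fun h ↦ hall fun p hp ↦ h p (mem_insert_of_mem hp)
        rw [if_neg this, if_neg hall]; ring

/-- **Legendre's identity**: for a finite set `S` of primes,
`N_S(h) = ∑_{t ⊆ S} (−1)^{#t} ⌊h / ∏_{p∈t} p⌋`. [cite: Soundararajan2007Distribution, Lecture 3 eq. (3.4) (proof)] -/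
theorem siftedCount_eq_sum (S : Finset ℕ) (hS : ∀ p ∈ S, p.Prime) (h : ℕ) :
    (siftedCount S h : ℝ) = ∑ t ∈ S.powerset, (-1 : ℝ) ^ #t * ((h / ∏ p ∈ t, p : ℕ) : ℝ) := by
  classical
  unfold siftedCount
  rw [Finset.card_filter, Nat.cast_sum]
  simp_rw [Nat.cast_ite, Nat.cast_one, Nat.cast_zero, indicator_sifted_eq_sum S hS]
  rw [sum_comm]
  refine sum_congr rfl fun t _ ↦ ?_
  rw [← mul_sum]
  congr 1
  have hIcc : Icc 1 h = Ioc 0 h := by ext n; simp; omega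
  rw [← Nat.Ioc_filter_dvd_card_eq_div h (∏ p ∈ t, p), hIcc, Finset.card_filter, Nat.cast_sum]
  simp

/-- `W(S) = ∑_{t ⊆ S} (−1)^{#t} ∏_{p ∈ t} 1/p`. [folklore] -/
theorem sieveDensity_eq_sum (S : Finset ℕ) :
    sieveDensity S = ∑ t ∈ S.powerset, (-1 : ℝ) ^ #t * ∏ p ∈ t, (p : ℝ)⁻¹ := by
  unfold sieveDensity
  simp_rw [sub_eq_add_neg]
  rw [prod_one_add]
  refine sum_congr rfl fun t _ ↦ ?_
  rw [prod_neg]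

/-! ## Recursions under `S ↦ S ∪ {q}` -/

/-- `W(S ∪ {q}) = (1 − 1/q) W(S)`. [folklore] -/
theorem sieveDensity_insert {S : Finset ℕ} {q : ℕ} (hq : q ∉ S) :
    sieveDensity (insert q S) = (1 - (q : ℝ)⁻¹) * sieveDensity S := by
  unfold sieveDensity
  rw [prod_insert hq]

/-- `e_0(S) = 1`. [folklore] -/
theorem eSymm_zero (S : Finset ℕ) : eSymm S 0 = 1 := by
  unfold eSymm
  rw [Finset.sum_ite, sum_const_zero, add_zero]
  have : S.powerset.filter (fun t ↦ #t = 0) = {∅} := by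
    ext t
    simp only [mem_filter, mem_powerset, card_eq_zero, mem_singleton]
    exact ⟨fun h ↦ h.2, fun h ↦ ⟨h ▸ empty_subset S, h⟩⟩
  rw [this, sum_singleton, prod_empty]

/-- `e_j(∅) = 0` for `j ≥ 1`. [folklore] -/
theorem eSymm_empty_of_pos {j : ℕ} (hj : j ≠ 0) : eSymm ∅ j = 0 := by
  unfold eSymm
  rw [powerset_empty, sum_singleton, card_empty, if_neg (Ne.symm hj)]

/-- `g_k(∅) = 0`. [folklore] -/
theorem gTail_empty (k : ℕ) : gTail ∅ k = 0 := by
  unfold gTail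
  rw [powerset_empty, sum_singleton, card_empty, if_neg (Nat.not_lt_zero k)]

/-- `e_{j+1}(S ∪ {q}) = e_{j+1}(S) + e_j(S)/q`. [folklore] -/
theorem eSymm_insert_succ {S : Finset ℕ} {q : ℕ} (hq : q ∉ S) (j : ℕ) :
    eSymm (insert q S) (j + 1) = eSymm S (j + 1) + (q : ℝ)⁻¹ * eSymm S j := by
  unfold eSymm
  rw [sum_powerset_insert hq, mul_sum]
  congr 1
  refine sum_congr rfl fun t ht ↦ ?_
  have hqt : q ∉ t := fun h ↦ hq (mem_powerset.1 ht h)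
  rw [card_insert_of_notMem hqt, prod_insert hqt]
  by_cases h : #t = j
  · rw [if_pos (by omega), if_pos h]
  · rw [if_neg (by omega), if_neg h, mul_zero]

/-- `e_1(S) = ∑_{p ∈ S} 1/p`. [folklore] -/
theorem eSymm_one (S : Finset ℕ) : eSymm S 1 = ∑ p ∈ S, (p : ℝ)⁻¹ := by
  classical
  induction S using Finset.induction_on with
  | empty => exact eSymm_empty_of_pos one_ne_zero
  | insert q S hq ih => rw [eSymm_insert_succ hq 0, eSymm_zero, ih, sum_insert hq]; ring

/-- `e_j(S) ≥ 0`. [folklore] -/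
theorem eSymm_nonneg (S : Finset ℕ) (j : ℕ) : 0 ≤ eSymm S j := by
  unfold eSymm
  refine sum_nonneg fun t _ ↦ ?_
  split_ifs
  · exact prod_nonneg fun p _ ↦ inv_nonneg.2 (Nat.cast_nonneg p)
  · exact le_rfl

/-- `0 ≤ W(S) ≤ 1`. [folklore] -/
theorem sieveDensity_nonneg_le_one (S : Finset ℕ) : 0 ≤ sieveDensity S ∧ sieveDensity S ≤ 1 := by
  unfold sieveDensity
  refine ⟨prod_nonneg fun p _ ↦ ?_, prod_le_one (fun p _ ↦ ?_) fun p _ ↦ ?_⟩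
  · exact sub_nonneg.2 (Nat.cast_inv_le_one p)
  · exact sub_nonneg.2 (Nat.cast_inv_le_one p)
  · exact sub_le_self _ (inv_nonneg.2 (Nat.cast_nonneg p))

/-- **The tail recursion**: `g_k(S ∪ {q}) = (1 − 1/q) g_k(S) + e_k(S)/q` for `q ∉ S`. (The subsets of
`S ∪ {q}` containing `q` with more than `k` elements are `t ∪ {q}` with `#t ≥ k`; those with `#t = k`
contribute `e_k(S)/q`, the others `−g_k(S)/q`.) [folklore] -/
theorem gTail_insert {S : Finset ℕ} {q : ℕ} (hq : q ∉ S) (k : ℕ) :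
    gTail (insert q S) k = (1 - (q : ℝ)⁻¹) * gTail S k + (q : ℝ)⁻¹ * eSymm S k := by
  unfold gTail eSymm
  rw [sum_powerset_insert hq, sub_mul, one_mul, mul_sum, mul_sum, sub_add, ← sum_sub_distrib]
  congr 1
  rw [← sum_neg_distrib]
  refine sum_congr rfl fun t ht ↦ ?_
  have hqt : q ∉ t := fun h ↦ hq (mem_powerset.1 ht h)
  rw [card_insert_of_notMem hqt, prod_insert hqt]
  rcases Nat.lt_trichotomy k #t with hlt | heq | hgt
  · rw [if_pos (by omega), if_pos hlt, if_neg (by omega)]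
    have : (-1 : ℝ) ^ (#t + 1 + k + 1) = -(-1) ^ (#t + k + 1) := by ring
    rw [this]; ring
  · rw [if_pos (by omega), if_neg (by omega), if_pos heq.symm]
    have : (-1 : ℝ) ^ (#t + 1 + k + 1) = 1 := by
      rw [heq]; ring_nf; norm_num
    rw [this]; ring
  · rw [if_neg (by omega), if_neg (by omega), if_neg (by omega)]; ring

/-- **`W(S) e_{k+1}(S) ≤ g_k(S)`** (in particular `g_k(S) ≥ 0`): by induction on `S` with
`gTail_insert`, `eSymm_insert_succ`, `sieveDensity_insert` and `0 ≤ 1/q ≤ 1`, `0 ≤ W ≤ 1`.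
[folklore] -/
theorem sieveDensity_mul_eSymm_le_gTail (S : Finset ℕ) (k : ℕ) :
    sieveDensity S * eSymm S (k + 1) ≤ gTail S k := by
  classical
  induction S using Finset.induction_on with
  | empty => rw [eSymm_empty_of_pos (Nat.succ_ne_zero k), gTail_empty, mul_zero]
  | insert q S hq ih =>
    rw [gTail_insert hq, eSymm_insert_succ hq, sieveDensity_insert hq]
    obtain ⟨hW0, hW1⟩ := sieveDensity_nonneg_le_one S
    have hx0 : 0 ≤ (q : ℝ)⁻¹ := inv_nonneg.2 (Nat.cast_nonneg q)
    have hx1 : (q : ℝ)⁻¹ ≤ 1 := Nat.cast_inv_le_one q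
    have he := eSymm_nonneg S k
    have h1 : (1 - (q : ℝ)⁻¹) * sieveDensity S ≤ 1 := by nlinarith
    have h2 : (1 - (q : ℝ)⁻¹) * sieveDensity S * ((q : ℝ)⁻¹ * eSymm S k) ≤ (q : ℝ)⁻¹ * eSymm S k := by
      have : 0 ≤ (q : ℝ)⁻¹ * eSymm S k := mul_nonneg hx0 he
      nlinarith
    have h3 : (1 - (q : ℝ)⁻¹) * (sieveDensity S * eSymm S (k + 1)) ≤ (1 - (q : ℝ)⁻¹) * gTail S k :=
      mul_le_mul_of_nonneg_left ih (by linarith)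
    nlinarith

/-- `g_k(S) ≥ 0`. [folklore] -/
theorem gTail_nonneg (S : Finset ℕ) (k : ℕ) : 0 ≤ gTail S k :=
  le_trans (mul_nonneg (sieveDensity_nonneg_le_one S).1 (eSymm_nonneg S _))
    (sieveDensity_mul_eSymm_le_gTail S k)

/-! ## A lower bound for the elementary symmetric functions -/

/-- For `x ≥ 0`, `j ≥ 1` and real `a`: `(a + x)_+^j ≤ a_+^j + j x (a + x)_+^{j−1}` (mean value
inequality for `t ↦ t_+^j`). [folklore] -/
theorem posPart_add_pow_le {a x : ℝ} (hx : 0 ≤ x) {j : ℕ} (hj : 1 ≤ j) :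
    max (a + x) 0 ^ j ≤ max a 0 ^ j + j * x * max (a + x) 0 ^ (j - 1) := by
  obtain ⟨i, rfl⟩ : ∃ i, j = i + 1 := ⟨j - 1, by omega⟩
  simp only [Nat.add_sub_cancel]
  have ha0 : 0 ≤ max a 0 := le_max_right _ _
  by_cases hax : a + x ≤ 0
  · rw [max_eq_right hax, zero_pow (Nat.succ_ne_zero i)]
    have : 0 ≤ ((i + 1 : ℕ) : ℝ) * x * 0 ^ i := by positivity
    nlinarith [pow_nonneg ha0 (i + 1)]
  push Not at hax
  rw [max_eq_left hax.le]
  by_cases ha : a ≤ 0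
  · -- `(a+x)^{i+1} = (a+x)(a+x)^i ≤ x (a+x)^i ≤ (i+1) x (a+x)^i`
    have h1 : (a + x) ^ (i + 1) ≤ x * (a + x) ^ i := by
      rw [pow_succ', mul_comm]
      rw [mul_comm x]
      exact mul_le_mul_of_nonneg_left (by linarith) (pow_nonneg hax.le i)
    have h2 : x * (a + x) ^ i ≤ ((i + 1 : ℕ) : ℝ) * x * (a + x) ^ i := by
      have : (1 : ℝ) ≤ ((i + 1 : ℕ) : ℝ) := by exact_mod_cast Nat.le_add_left 1 i
      have h0 : 0 ≤ x * (a + x) ^ i := mul_nonneg hx (pow_nonneg hax.le i)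
      nlinarith
    nlinarith [pow_nonneg ha0 (i + 1)]
  · push Not at ha
    rw [max_eq_left ha.le]
    -- `(a+x)^{i+1} − a^{i+1} = x ∑_{l ≤ i} (a+x)^l a^{i−l} ≤ (i+1) x (a+x)^i`
    have hgeom := geom_sum₂_mul (a + x) a (i + 1)
    rw [add_sub_cancel_left] at hgeom
    have hsum : ∑ l ∈ range (i + 1), (a + x) ^ l * a ^ (i + 1 - 1 - l) ≤
        ∑ l ∈ range (i + 1), (a + x) ^ i := by
      refine sum_le_sum fun l hl ↦ ?_
      have hl' : l ≤ i := Nat.lt_succ_iff.1 (mem_range.1 hl)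
      have e1 : i + 1 - 1 - l = i - l := by omega
      rw [e1]
      calc (a + x) ^ l * a ^ (i - l) ≤ (a + x) ^ l * (a + x) ^ (i - l) := by
            refine mul_le_mul_of_nonneg_left (pow_le_pow_left₀ ha.le (by linarith) _) ?_
            exact pow_nonneg hax.le l
        _ = (a + x) ^ i := by rw [← pow_add]; congr 1; omega
    rw [sum_const, card_range, nsmul_eq_mul] at hsum
    have : (a + x) ^ (i + 1) - a ^ (i + 1) ≤ ((i + 1 : ℕ) : ℝ) * (a + x) ^ i * x := by
      rw [← hgeom]
      exact mul_le_mul_of_nonneg_right hsum hx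
    linarith

/-- **Lower bound for `e_j`**: if `1/p ≤ m` for all `p ∈ S` (`m ≥ 0`), then for every `j`,
`(e_1(S) − (j − 1) m)_+^j / j! ≤ e_j(S)`. By induction on `S`: `e_j(S ∪ {q}) = e_j(S) + e_{j−1}(S)/q`
and `posPart_add_pow_le` with `a = e_1(S) − (j−1)m`, `x = 1/q ≤ m`. [folklore] -/
theorem pow_div_factorial_le_eSymm (S : Finset ℕ) {m : ℝ} (hm0 : 0 ≤ m)
    (hm : ∀ p ∈ S, (p : ℝ)⁻¹ ≤ m) (j : ℕ) :
    max (eSymm S 1 - ((j : ℝ) - 1) * m) 0 ^ j / j.factorial ≤ eSymm S j := by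
  classical
  induction S using Finset.induction_on generalizing j with
  | empty =>
    rcases Nat.eq_zero_or_pos j with rfl | hj
    · simp [eSymm_zero]
    · rw [eSymm_empty_of_pos hj.ne', eSymm_empty_of_pos one_ne_zero]
      have hj1 : (1 : ℝ) ≤ j := by exact_mod_cast hj
      have : max (0 - ((j : ℝ) - 1) * m) 0 = 0 := max_eq_right (by nlinarith)
      rw [this, zero_pow hj.ne', zero_div]
  | insert q S hq ih =>
    have hmS : ∀ p ∈ S, (p : ℝ)⁻¹ ≤ m := fun p hp ↦ hm p (mem_insert_of_mem hp)
    have hxm : (q : ℝ)⁻¹ ≤ m := hm q (mem_insert_self q S)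
    have hx0 : 0 ≤ (q : ℝ)⁻¹ := inv_nonneg.2 (Nat.cast_nonneg q)
    rcases Nat.eq_zero_or_pos j with rfl | hj
    · simp [eSymm_zero]
    obtain ⟨i, rfl⟩ : ∃ i, j = i + 1 := ⟨j - 1, by omega⟩
    rw [eSymm_insert_succ hq i, eSymm_insert_succ hq 0, eSymm_zero, mul_one, zero_add]
    set s := eSymm S 1 with hs
    have hi1 := ih hmS (i + 1)
    have hi := ih hmS i
    push_cast at hi1 ⊢
    simp only [add_sub_cancel_right] at hi1 ⊢
    -- `a = s − i m`, `x = 1/q`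
    set a : ℝ := s - (i : ℝ) * m with ha
    have hkey := posPart_add_pow_le (a := a) hx0 (Nat.le_add_left 1 i)
    simp only [Nat.add_sub_cancel] at hkey
    have hmono : max (a + (q : ℝ)⁻¹) 0 ^ i ≤ max (s - ((i : ℝ) - 1) * m) 0 ^ i := by
      refine pow_le_pow_left₀ (le_max_right _ _) (max_le_max_right 0 ?_) i
      rw [ha]; nlinarith
    have hfac : ((i + 1).factorial : ℝ) = ((i + 1 : ℕ) : ℝ) * i.factorial := by
      rw [Nat.factorial_succ]; push_cast; ring
    have hfac0 : (0 : ℝ) < i.factorial := by exact_mod_cast i.factorial_pos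
    have hi0 : (0 : ℝ) < ((i + 1 : ℕ) : ℝ) := by exact_mod_cast Nat.succ_pos i
    have e1 : s + (q : ℝ)⁻¹ - (i : ℝ) * m = a + (q : ℝ)⁻¹ := by rw [ha]; ring
    rw [e1]
    -- divide `hkey` by `(i+1)!`
    have h1 : max (a + (q : ℝ)⁻¹) 0 ^ (i + 1) / ((i + 1).factorial : ℝ) ≤
        max a 0 ^ (i + 1) / ((i + 1).factorial : ℝ) +
          (q : ℝ)⁻¹ * (max (s - ((i : ℝ) - 1) * m) 0 ^ i / (i.factorial : ℝ)) := by
      have h2 : ((i + 1 : ℕ) : ℝ) * (q : ℝ)⁻¹ * max (a + (q : ℝ)⁻¹) 0 ^ i / ((i + 1).factorial : ℝ)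
          = (q : ℝ)⁻¹ * (max (a + (q : ℝ)⁻¹) 0 ^ i / (i.factorial : ℝ)) := by
        rw [hfac]; field_simp
      have h3 : (q : ℝ)⁻¹ * (max (a + (q : ℝ)⁻¹) 0 ^ i / (i.factorial : ℝ)) ≤
          (q : ℝ)⁻¹ * (max (s - ((i : ℝ) - 1) * m) 0 ^ i / (i.factorial : ℝ)) :=
        mul_le_mul_of_nonneg_left (div_le_div_of_nonneg_right hmono hfac0.le) hx0
      calc max (a + (q : ℝ)⁻¹) 0 ^ (i + 1) / ((i + 1).factorial : ℝ)
          ≤ (max a 0 ^ (i + 1) + ((i + 1 : ℕ) : ℝ) * (q : ℝ)⁻¹ * max (a + (q : ℝ)⁻¹) 0 ^ i) /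
              ((i + 1).factorial : ℝ) := div_le_div_of_nonneg_right hkey (by positivity)
        _ = max a 0 ^ (i + 1) / ((i + 1).factorial : ℝ) +
              (q : ℝ)⁻¹ * (max (a + (q : ℝ)⁻¹) 0 ^ i / (i.factorial : ℝ)) := by
            rw [add_div, h2]
        _ ≤ _ := by linarith [h3]
    have h4 : max a 0 ^ (i + 1) / ((i + 1).factorial : ℝ) ≤ eSymm S (i + 1) := by
      have := hi1; rwa [ha]
    nlinarith [h1, h4, hi, hx0]

/-! ## The truncation estimate -/

/-- The number of subsets of `S` with at most `k` elements is at most `(k+1)(#S+1)^k`. [folklore] -/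
theorem card_filter_card_le_le (S : Finset ℕ) (k : ℕ) :
    (#{t ∈ S.powerset | ¬ k < #t} : ℝ) ≤ (k + 1) * (#S + 1) ^ k := by
  classical
  have hfib := Finset.card_eq_sum_card_fiberwise (s := {t ∈ S.powerset | ¬ k < #t})
    (t := range (k + 1)) (f := fun t ↦ #t) (fun t ht ↦ by
      simp only [mem_coe, mem_filter, mem_range] at ht ⊢
      omega)
  have hle : ∀ i ∈ range (k + 1), #{t ∈ {t ∈ S.powerset | ¬ k < #t} | #t = i} ≤ (#S + 1) ^ k := by
    intro i hi
    have hik : i ≤ k := Nat.lt_succ_iff.1 (mem_range.1 hi)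
    calc #{t ∈ {t ∈ S.powerset | ¬ k < #t} | #t = i} ≤ #(powersetCard i S) := by
          refine card_le_card fun t ht ↦ ?_
          simp only [mem_filter, mem_powerset] at ht
          exact mem_powersetCard.2 ⟨ht.1.1, ht.2⟩
      _ = (#S).choose i := card_powersetCard i S
      _ ≤ (#S) ^ i := Nat.choose_le_pow _ _
      _ ≤ (#S + 1) ^ i := Nat.pow_le_pow_left (Nat.le_succ _) i
      _ ≤ (#S + 1) ^ k := Nat.pow_le_pow_right (Nat.succ_pos _) hik
  have : #{t ∈ S.powerset | ¬ k < #t} ≤ (k + 1) * (#S + 1) ^ k := by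
    rw [hfib]
    calc ∑ i ∈ range (k + 1), #{t ∈ {t ∈ S.powerset | ¬ k < #t} | #t = i}
        ≤ ∑ i ∈ range (k + 1), (#S + 1) ^ k := sum_le_sum hle
      _ = (k + 1) * (#S + 1) ^ k := by rw [sum_const, card_range, smul_eq_mul]
  exact_mod_cast this

/-- **Exact truncation of Legendre's sum.** Let `S` be a finite set of primes all exceeding
`w ≥ 1`, and `h ≤ w^{k+1}`. Then every product of more than `k` primes of `S` exceeds `h`, so
`N_S(h) − hW(S) = ∑_{#t ≤ k} (−1)^{#t}(⌊h/∏t⌋ − h/∏t) − h ∑_{#t > k} (−1)^{#t}/∏t`, i.e.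
`|N_S(h) − h W(S) − (−1)^k h g_k(S)| ≤ #{t ⊆ S : #t ≤ k} ≤ (k+1)(#S+1)^k`.
[cite: Soundararajan2007Distribution, Lecture 3, (3.3)–(3.4) and Exercise 11] -/
theorem abs_siftedCount_sub_le (S : Finset ℕ) (hS : ∀ p ∈ S, p.Prime) {w : ℝ} (hw : 1 ≤ w)
    (hSw : ∀ p ∈ S, w < p) (h k : ℕ) (hh : (h : ℝ) ≤ w ^ (k + 1)) :
    |(siftedCount S h : ℝ) - h * sieveDensity S - (-1) ^ k * h * gTail S k| ≤
      (k + 1) * (#S + 1) ^ k := by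
  classical
  rw [siftedCount_eq_sum S hS, sieveDensity_eq_sum, gTail, mul_sum, mul_sum, ← sum_sub_distrib,
    ← sum_sub_distrib]
  refine (abs_sum_le_sum_abs _ _).trans ?_
  refine le_trans (sum_le_sum (g := fun t ↦ if ¬ k < #t then (1 : ℝ) else 0) fun t ht ↦ ?_) ?_
  swap
  · rw [sum_boole]
    exact card_filter_card_le_le S k
  have htS : t ⊆ S := mem_powerset.1 ht
  have hP : ∏ p ∈ t, (p : ℝ)⁻¹ = (∏ p ∈ t, (p : ℝ))⁻¹ := prod_inv_distrib _
  have hcast : ((∏ p ∈ t, p : ℕ) : ℝ) = ∏ p ∈ t, (p : ℝ) := Nat.cast_prod _ _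
  have hdpos : (0 : ℝ) < ∏ p ∈ t, (p : ℝ) :=
    prod_pos fun p hp ↦ lt_of_lt_of_le (lt_of_lt_of_le one_pos hw) (hSw p (htS hp)).le
  by_cases hkt : k < #t
  · -- `∏ t > h`, the floor vanishes and the two other terms cancel
    rw [if_neg (not_not_intro hkt), if_pos hkt]
    have hbig : (h : ℝ) < ∏ p ∈ t, (p : ℝ) := by
      have hne : t.Nonempty := card_pos.1 (by omega)
      have h1 : w ^ #t < ∏ p ∈ t, (p : ℝ) := by
        rw [← prod_const]
        exact prod_lt_prod_of_nonempty (fun p _ ↦ by linarith) (fun p hp ↦ hSw p (htS hp)) hne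
      have h2 : w ^ (k + 1) ≤ w ^ #t := pow_le_pow_right₀ hw hkt
      linarith
    have hdiv : h / ∏ p ∈ t, p = 0 := by
      refine Nat.div_eq_of_lt ?_
      exact_mod_cast (hcast ▸ hbig : (h : ℝ) < ((∏ p ∈ t, p : ℕ) : ℝ))
    rw [hdiv, Nat.cast_zero, mul_zero, pow_add, pow_add, pow_one]
    have hk2 : ((-1 : ℝ) ^ k) ^ 2 = 1 := by
      rw [← pow_mul, mul_comm, pow_mul, neg_one_sq, one_pow]
    have hzero : (0 : ℝ) - h * ((-1) ^ #t * ∏ p ∈ t, (p : ℝ)⁻¹) -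
        (-1) ^ k * h * ((-1) ^ #t * (-1) ^ k * -1 * ∏ p ∈ t, (p : ℝ)⁻¹) = 0 := by
      linear_combination ((h : ℝ) * (-1) ^ #t * ∏ p ∈ t, (p : ℝ)⁻¹) * hk2
    simp only [hzero, abs_zero, le_refl]
  · -- `#t ≤ k`: a floor error of modulus `< 1`
    rw [if_pos hkt, if_neg hkt, mul_zero, sub_zero]
    have hfl : ((h / ∏ p ∈ t, p : ℕ) : ℝ) = ⌊(h : ℝ) / ∏ p ∈ t, (p : ℝ)⌋₊ := by
      rw [← hcast, Nat.floor_div_eq_div]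
    have hup : ((h / ∏ p ∈ t, p : ℕ) : ℝ) ≤ (h : ℝ) / ∏ p ∈ t, (p : ℝ) := by
      rw [← hcast]; exact Nat.cast_div_le
    have hlow : (h : ℝ) / ∏ p ∈ t, (p : ℝ) - 1 < ((h / ∏ p ∈ t, p : ℕ) : ℝ) := by
      rw [hfl]; exact Nat.sub_one_lt_floor _
    have habs1 : |(-1 : ℝ) ^ #t| = 1 := by rw [abs_pow, abs_neg, abs_one, one_pow]
    have e : (-1 : ℝ) ^ #t * ((h / ∏ p ∈ t, p : ℕ) : ℝ) -
        (h : ℝ) * ((-1) ^ #t * (∏ p ∈ t, (p : ℝ))⁻¹) =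
        (-1) ^ #t * (((h / ∏ p ∈ t, p : ℕ) : ℝ) - (h : ℝ) / ∏ p ∈ t, (p : ℝ)) := by
      rw [div_eq_mul_inv]; ring
    rw [hP, e, abs_mul, habs1, one_mul, abs_le]
    constructor <;> linarith

/-- **Even `k`: more sifted numbers than expected.** Under the hypotheses of
`abs_siftedCount_sub_le` with `k` even, `N_S(h) ≥ h W(S)(1 + e_{k+1}(S)) − (k+1)(#S+1)^k`.
[cite: Soundararajan2007Distribution, Lecture 3 Exercise 11] -/
theorem siftedCount_ge_of_even (S : Finset ℕ) (hS : ∀ p ∈ S, p.Prime) {w : ℝ} (hw : 1 ≤ w)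
    (hSw : ∀ p ∈ S, w < p) (h k : ℕ) (hk : Even k) (hh : (h : ℝ) ≤ w ^ (k + 1)) :
    h * sieveDensity S * (1 + eSymm S (k + 1)) - (k + 1) * (#S + 1) ^ k ≤ siftedCount S h := by
  have h1 := abs_siftedCount_sub_le S hS hw hSw h k hh
  rw [hk.neg_one_pow, one_mul, abs_le] at h1
  have h2 := sieveDensity_mul_eSymm_le_gTail S k
  have h0 : (0 : ℝ) ≤ h := Nat.cast_nonneg h
  nlinarith [h1.1, mul_le_mul_of_nonneg_left h2 h0]

/-- **Odd `k`: fewer sifted numbers than expected.** Under the hypotheses of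
`abs_siftedCount_sub_le` with `k` odd, `N_S(h) ≤ h W(S)(1 − e_{k+1}(S)) + (k+1)(#S+1)^k`.
[cite: Soundararajan2007Distribution, Lecture 3 Exercise 11] -/
theorem siftedCount_le_of_odd (S : Finset ℕ) (hS : ∀ p ∈ S, p.Prime) {w : ℝ} (hw : 1 ≤ w)
    (hSw : ∀ p ∈ S, w < p) (h k : ℕ) (hk : Odd k) (hh : (h : ℝ) ≤ w ^ (k + 1)) :
    (siftedCount S h : ℝ) ≤ h * sieveDensity S * (1 - eSymm S (k + 1)) + (k + 1) * (#S + 1) ^ k := by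
  have h1 := abs_siftedCount_sub_le S hS hw hSw h k hh
  rw [hk.neg_one_pow, abs_le] at h1
  have h2 := sieveDensity_mul_eSymm_le_gTail S k
  have h0 : (0 : ℝ) ≤ h := Nat.cast_nonneg h
  nlinarith [h1.2, mul_le_mul_of_nonneg_left h2 h0]

/-! ## Glue: the modulus `P = ∏_{p ∈ S} p` -/

/-- For a set `S` of primes, `j` is coprime to `P = ∏_{p∈S} p` iff no `p ∈ S` divides `j`; hence
`N_S(h) = #{1 ≤ j ≤ h : (j, P) = 1}`. [folklore] -/
theorem coprime_prod_iff (S : Finset ℕ) (hS : ∀ p ∈ S, p.Prime) (j : ℕ) :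
    j.Coprime (∏ p ∈ S, p) ↔ ∀ p ∈ S, ¬ p ∣ j := by
  rw [Nat.coprime_prod_right_iff]
  refine forall₂_congr fun p hp ↦ ?_
  rw [Nat.coprime_comm, (hS p hp).coprime_iff_not_dvd]

/-- `N_S(h) = #{1 ≤ j ≤ h : (j, ∏_{p∈S} p) = 1}`. [folklore] -/
theorem siftedCount_eq_card_coprime (S : Finset ℕ) (hS : ∀ p ∈ S, p.Prime) (h : ℕ) :
    siftedCount S h = #{j ∈ Icc 1 h | j.Coprime (∏ p ∈ S, p)} := by
  unfold siftedCount
  congr 1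
  exact filter_congr fun j _ ↦ (coprime_prod_iff S hS j).symm

/-- `φ(P) = ∏_{p ∈ S} (p − 1)` for `P = ∏_{p∈S} p`, `S` a set of primes. [folklore] -/
theorem totient_prod_primes (S : Finset ℕ) (hS : ∀ p ∈ S, p.Prime) :
    Nat.totient (∏ p ∈ S, p) = ∏ p ∈ S, (p - 1) := by
  have hP : (∏ p ∈ S, p).primeFactors = S := Nat.primeFactors_prod hS
  have h := Nat.totient_mul_prod_primeFactors (∏ p ∈ S, p)
  rw [hP] at h
  have hpos : 0 < ∏ p ∈ S, p := prod_pos fun p hp ↦ (hS p hp).pos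
  rw [mul_comm] at h
  exact Nat.eq_of_mul_eq_mul_left hpos h

/-- `W(S) = φ(P)/P` for `P = ∏_{p∈S} p`, `S` a set of primes. [folklore] -/
theorem sieveDensity_eq_totient_div (S : Finset ℕ) (hS : ∀ p ∈ S, p.Prime) :
    sieveDensity S = (Nat.totient (∏ p ∈ S, p) : ℝ) / ((∏ p ∈ S, p : ℕ) : ℝ) := by
  rw [totient_prod_primes S hS, Nat.cast_prod, Nat.cast_prod, ← prod_div_distrib]
  unfold sieveDensity
  refine prod_congr rfl fun p hp ↦ ?_
  have hp0 : (p : ℝ) ≠ 0 := by exact_mod_cast (hS p hp).ne_zero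
  rw [Nat.cast_sub (hS p hp).one_le, Nat.cast_one, sub_div, div_self hp0, one_div]

/-- **Weierstrass**: `W(S) ≥ 1 − ∑_{p∈S} 1/p`. [folklore] -/
theorem one_sub_sum_le_sieveDensity (S : Finset ℕ) :
    1 - ∑ p ∈ S, (p : ℝ)⁻¹ ≤ sieveDensity S := by
  classical
  induction S using Finset.induction_on with
  | empty => simp [sieveDensity]
  | insert q S hq ih =>
    rw [sieveDensity_insert hq, sum_insert hq]
    have hx0 : 0 ≤ (q : ℝ)⁻¹ := inv_nonneg.2 (Nat.cast_nonneg q)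
    have hx1 : (q : ℝ)⁻¹ ≤ 1 := Nat.cast_inv_le_one q
    have hs0 : 0 ≤ ∑ p ∈ S, (p : ℝ)⁻¹ := sum_nonneg fun p _ ↦ inv_nonneg.2 (Nat.cast_nonneg p)
    have h1 : (1 - (q : ℝ)⁻¹) * (1 - ∑ p ∈ S, (p : ℝ)⁻¹) ≤ (1 - (q : ℝ)⁻¹) * sieveDensity S :=
      mul_le_mul_of_nonneg_left ih (by linarith)
    nlinarith

end Literature.NumberTheory.Sieve.MaierMatrix
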